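import Mathlib
import Summits.RiemannHypothesis.RiemannHypothesis.Theorems.WeilFarFloorCoshTest
import Literature.NumberTheory.LFunctions.VonKochTheorem
import Literature.NumberTheory.LFunctions.MertensFirstVonMangoldtUpper
import HarnessLib

/-!
# Under RH the cosh profile is an approximate eigenvector of the prime-shift operator (the coupling is `O(b^{5/2})√P`)

Helper file (`--supports stmt-RiemannHypothesis-0098`, lead-track anchor: Weil-positivity window ladder, format-C far bound),
pure proofs.  Seat rh-explicit-weil-1 gen12 (memo `run/shared/lean/pub/rh-explicit/rh-explicit-weil-1/FORMAT-K3.md` §13.5): stage 1 of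
C-XIII″ under RH («the cosh test is asymptotically THE extremal»).

The prime-shift OPERATOR of the window `b`, `(T_b f)(x) = Σ_{log n < 2b} (Λ(n)/√n)(f(x − log n) + f(x + log n))`, represents the
prime-shift form: `Q_b(f + g) = Q_b(f) + Q_b(g) + 2∫ (T_b f)·g`.  On the cosh profile `C_b = cosh(·/2)·1_{[−b,b]}` it acts IN CLOSED FORM
(`primeShiftOp_coshProfile_eq`): for `|x| < b`,

  `(T_b C_b)(x) = ½e^{x/2}(H(e^{b+x}) + ψ(e^{b−x})) + ½e^{−x/2}(ψ(e^{b+x}) + H(e^{b−x}))`,   `H(y) = Σ_{n≤y} Λ(n)/n`, `ψ` = Chebyshev,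

so that `T_b C_b − (e^b + b)C_b = x sinh(x/2) + ½e^{x/2}[(H(e^{b+x}) − (b+x)) + (ψ(e^{b−x}) − e^{b−x})] + ½e^{−x/2}[(ψ(e^{b+x}) − e^{b+x}) + (H(e^{b−x}) − (b−x))]`
(`primeShiftOp_coshProfile_sub_eq`).  Mertens (`|H(y) − log y| ≤ 4`, tree) and VON KOCH under RH (`ψ(y) − y = O(√y log²y)`, Literature
`vonKoch_chebyshevPsi_of_riemannHypothesis_holds`) give (`primeShiftOp_coshProfile_sub_sq_le_of_RH`, `integral_primeShiftOp_coshProfile_sub_sq_le_of_RH`):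

  **RH → ∃ K ∀ b ≥ 1: `∫_{(−b,b)} ((T_b C_b)(x) − (e^b + b)C_b(x))² dx ≤ K·b⁵·(b + sinh b)`** (`‖C_b‖² = b + sinh b`).

This is the COUPLING `β(b)² = ‖P^⊥T_bC_b‖²/‖C_b‖² = O(b⁵)` of the cosh profile to its orthogonal complement (gen9 measured `β ≈ 0.5` for the
exact PNT eigenfunction): `|Q_b(cC_b + r) − c²Q_b(C_b) − Q_b(r)| ≤ 2|c|·(√(Kb⁵P) + (e^b + b)|⟨C_b, r⟩|/… )·‖r‖`, the one number-theoretic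
input of the zero-energy refinement of the cosh split (FORMAT-K3 §13.5).  Standard axioms only; RH enters as Mathlib's `RiemannHypothesis`.
-/

set_option linter.dupNamespace false
set_option autoImplicit false

noncomputable section

open MeasureTheory Set Filter Asymptotics
open scoped Real Topology ArithmeticFunction.vonMangoldt Chebyshev

namespace Summit.RiemannHypothesis.RiemannHypothesis.Theorems.WeilFormatC

namespace FloorCoshSplit

open Literature.NumberTheory.LFunctions FloorCosh

variable {b : ℝ}

/-! ## §1 The prime-shift operator on the cosh profile, in closed form -/

/-- One shifted term: for `1 ≤ n ≤ e^{b+x}` and `x ≤ b`,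
`(Λ(n)/√n)·C_b(x − log n) = Λ(n)(e^{x/2}/n + e^{−x/2})/2`. -/
theorem vonMangoldt_div_sqrt_mul_coshProfile_sub {n : ℕ} (hn : 1 ≤ n) {x : ℝ} (hxb : x ≤ b)
    (hnx : (n : ℝ) ≤ Real.exp (b + x)) :
    (Λ n : ℝ) / Real.sqrt n * (Icc (-b) b).indicator (fun y ↦ Real.cosh (y / 2)) (x - Real.log n)
      = (Λ n : ℝ) * (Real.exp (x / 2) / n + Real.exp (-(x / 2))) / 2 := by
  have hn0 : (0 : ℝ) < n := by exact_mod_cast hn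
  have hlog0 : 0 ≤ Real.log n := Real.log_nonneg (by exact_mod_cast hn)
  have hlog : Real.log n ≤ b + x := by rw [Real.log_le_iff_le_exp hn0]; exact hnx
  have hmem : x - Real.log n ∈ Icc (-b) b := ⟨by linarith, by linarith⟩
  rw [indicator_of_mem hmem, Real.cosh_eq]
  set s := Real.sqrt (n : ℝ) with hs
  have hs0 : 0 < s := Real.sqrt_pos.2 hn0
  have hss : s * s = n := Real.mul_self_sqrt hn0.le
  have hlogs : Real.log n = 2 * Real.log s := by rw [← hss, Real.log_mul hs0.ne' hs0.ne']; ring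
  have h1 : Real.exp ((x - Real.log n) / 2) = Real.exp (x / 2) / s := by
    rw [hlogs, show (x - 2 * Real.log s) / 2 = x / 2 - Real.log s by ring, Real.exp_sub, Real.exp_log hs0]
  have h2 : Real.exp (-((x - Real.log n) / 2)) = Real.exp (-(x / 2)) * s := by
    rw [hlogs, show -((x - 2 * Real.log s) / 2) = -(x / 2) + Real.log s by ring, Real.exp_add, Real.exp_log hs0]
  rw [h1, h2, ← hss]
  field_simp

/-- The mirrored term: for `1 ≤ n ≤ e^{b−x}` and `−b ≤ x`, `(Λ(n)/√n)·C_b(x + log n) = Λ(n)(e^{x/2} + e^{−x/2}/n)/2`. -/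
theorem vonMangoldt_div_sqrt_mul_coshProfile_add {n : ℕ} (hn : 1 ≤ n) {x : ℝ} (hxb : -b ≤ x)
    (hnx : (n : ℝ) ≤ Real.exp (b - x)) :
    (Λ n : ℝ) / Real.sqrt n * (Icc (-b) b).indicator (fun y ↦ Real.cosh (y / 2)) (x + Real.log n)
      = (Λ n : ℝ) * (Real.exp (x / 2) + Real.exp (-(x / 2)) / n) / 2 := by
  have h := vonMangoldt_div_sqrt_mul_coshProfile_sub (b := b) hn (x := -x) (by linarith) (by rwa [← sub_eq_add_neg])
  have e1 : (Icc (-b) b).indicator (fun y ↦ Real.cosh (y / 2)) (x + Real.log n)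
      = (Icc (-b) b).indicator (fun y ↦ Real.cosh (y / 2)) (-x - Real.log n) := by
    have hsym : ∀ y, (Icc (-b) b).indicator (fun y ↦ Real.cosh (y / 2)) (-y)
        = (Icc (-b) b).indicator (fun y ↦ Real.cosh (y / 2)) y := by
      intro y
      by_cases hy : y ∈ Icc (-b) b
      · have hy' : -y ∈ Icc (-b) b := ⟨by linarith [hy.2], by linarith [hy.1]⟩
        rw [indicator_of_mem hy, indicator_of_mem hy', neg_div, Real.cosh_neg]
      · have hy' : -y ∉ Icc (-b) b := fun h ↦ hy ⟨by linarith [h.2], by linarith [h.1]⟩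
        rw [indicator_of_notMem hy, indicator_of_notMem hy']
    rw [← hsym, show -(x + Real.log n) = -x - Real.log n by ring]
  rw [e1, h, neg_div, neg_neg]
  ring

/-- **The prime-shift operator on the cosh profile**: for `|x| < b`,
`Σ_{log n<2b} (Λ(n)/√n)(C_b(x − log n) + C_b(x + log n)) = ½e^{x/2}(H(e^{b+x}) + ψ(e^{b−x})) + ½e^{−x/2}(ψ(e^{b+x}) + H(e^{b−x}))`,
`H(y) = Σ_{0<n≤y} Λ(n)/n`. -/
theorem primeShiftOp_coshProfile_eq {x : ℝ} (hx : x ∈ Ioo (-b) b) :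
    ∑ n ∈ weilPrimeIndex b, (Λ n : ℝ) / Real.sqrt n *
        ((Icc (-b) b).indicator (fun y ↦ Real.cosh (y / 2)) (x - Real.log n)
          + (Icc (-b) b).indicator (fun y ↦ Real.cosh (y / 2)) (x + Real.log n))
      = (Real.exp (x / 2) * (∑ n ∈ Finset.Ioc 0 ⌊Real.exp (b + x)⌋₊, (Λ n : ℝ) / n)
          + Real.exp (-(x / 2)) * ψ (Real.exp (b + x))) / 2
        + (Real.exp (x / 2) * ψ (Real.exp (b - x))
          + Real.exp (-(x / 2)) * (∑ n ∈ Finset.Ioc 0 ⌊Real.exp (b - x)⌋₊, (Λ n : ℝ) / n)) / 2 := by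
  set C := (Icc (-b) b).indicator (fun y ↦ Real.cosh (y / 2)) with hC
  -- membership bookkeeping
  have hsubW : ∀ {y : ℝ}, y < 2 * b → Finset.Ioc 0 ⌊Real.exp y⌋₊ ⊆ weilPrimeIndex b := by
    intro y hy n hn
    rw [Finset.mem_Ioc] at hn
    have hn0 : (0 : ℝ) < n := by exact_mod_cast hn.1
    refine mem_weilPrimeIndex.2 ?_
    have h1 : (n : ℝ) ≤ Real.exp y := (Nat.cast_le.2 hn.2).trans (Nat.floor_le (Real.exp_pos _).le)
    calc Real.log n ≤ y := by rw [Real.log_le_iff_le_exp hn0]; exact h1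
      _ < 2 * b := hy
  have hout : ∀ {y : ℝ} {n : ℕ}, n ∉ Finset.Ioc 0 ⌊Real.exp y⌋₊ → n = 0 ∨ Real.exp y < n := by
    intro y n hn
    rw [Finset.mem_Ioc, not_and_or, not_lt, not_le] at hn
    rcases hn with h | h
    · left; omega
    · right; exact Nat.lt_of_floor_lt h
  -- first half: shifts `x − log n`
  have hA : ∑ n ∈ weilPrimeIndex b, (Λ n : ℝ) / Real.sqrt n * C (x - Real.log n)
      = ∑ n ∈ Finset.Ioc 0 ⌊Real.exp (b + x)⌋₊, (Λ n : ℝ) * (Real.exp (x / 2) / n + Real.exp (-(x / 2))) / 2 := by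
    rw [← Finset.sum_subset (hsubW (y := b + x) (by linarith [hx.2])) (fun n _ hn' ↦ ?_)]
    · refine Finset.sum_congr rfl fun n hn ↦ ?_
      rw [Finset.mem_Ioc] at hn
      exact vonMangoldt_div_sqrt_mul_coshProfile_sub hn.1 hx.2.le
        ((Nat.cast_le.2 hn.2).trans (Nat.floor_le (Real.exp_pos _).le))
    · rcases hout hn' with h0 | hgt
      · subst h0; simp
      · have hn0 : (0 : ℝ) < n := (Real.exp_pos _).trans hgt
        have hlog : b + x < Real.log n := by rw [Real.lt_log_iff_exp_lt hn0]; exact hgt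
        have hnot : x - Real.log n ∉ Icc (-b) b := fun h ↦ by linarith [h.1]
        rw [hC, indicator_of_notMem hnot, mul_zero]
  -- second half: shifts `x + log n`
  have hB : ∑ n ∈ weilPrimeIndex b, (Λ n : ℝ) / Real.sqrt n * C (x + Real.log n)
      = ∑ n ∈ Finset.Ioc 0 ⌊Real.exp (b - x)⌋₊, (Λ n : ℝ) * (Real.exp (x / 2) + Real.exp (-(x / 2)) / n) / 2 := by
    rw [← Finset.sum_subset (hsubW (y := b - x) (by linarith [hx.1])) (fun n _ hn' ↦ ?_)]
    · refine Finset.sum_congr rfl fun n hn ↦ ?_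
      rw [Finset.mem_Ioc] at hn
      exact vonMangoldt_div_sqrt_mul_coshProfile_add hn.1 hx.1.le
        ((Nat.cast_le.2 hn.2).trans (Nat.floor_le (Real.exp_pos _).le))
    · rcases hout hn' with h0 | hgt
      · subst h0; simp
      · have hn0 : (0 : ℝ) < n := (Real.exp_pos _).trans hgt
        have hlog : b - x < Real.log n := by rw [Real.lt_log_iff_exp_lt hn0]; exact hgt
        have hnot : x + Real.log n ∉ Icc (-b) b := fun h ↦ by linarith [h.2]
        rw [hC, indicator_of_notMem hnot, mul_zero]
  simp_rw [mul_add]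
  rw [Finset.sum_add_distrib, hA, hB]
  unfold Chebyshev.psi
  have e1 : ∀ n : ℕ, (Λ n : ℝ) * (Real.exp (x / 2) / n + Real.exp (-(x / 2))) / 2
      = (Real.exp (x / 2) * ((Λ n : ℝ) / n) + Real.exp (-(x / 2)) * (Λ n : ℝ)) / 2 := fun n ↦ by ring
  have e2 : ∀ n : ℕ, (Λ n : ℝ) * (Real.exp (x / 2) + Real.exp (-(x / 2)) / n) / 2
      = (Real.exp (x / 2) * (Λ n : ℝ) + Real.exp (-(x / 2)) * ((Λ n : ℝ) / n)) / 2 := fun n ↦ by ring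
  simp_rw [e1, e2]
  rw [← Finset.sum_div, ← Finset.sum_div, Finset.sum_add_distrib, Finset.sum_add_distrib, ← Finset.mul_sum,
    ← Finset.mul_sum, ← Finset.mul_sum, ← Finset.mul_sum]

/-- **The deviation from an eigenvector, in closed form**: for `|x| < b`,
`(T_bC_b)(x) − (e^b + b)C_b(x) = x·sinh(x/2) + ½e^{x/2}[(H(e^{b+x}) − (b+x)) + (ψ(e^{b−x}) − e^{b−x})] + ½e^{−x/2}[(ψ(e^{b+x}) − e^{b+x}) + (H(e^{b−x}) − (b−x))]`. -/
theorem primeShiftOp_coshProfile_sub_eq {x : ℝ} (hx : x ∈ Ioo (-b) b) :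
    ∑ n ∈ weilPrimeIndex b, (Λ n : ℝ) / Real.sqrt n *
        ((Icc (-b) b).indicator (fun y ↦ Real.cosh (y / 2)) (x - Real.log n)
          + (Icc (-b) b).indicator (fun y ↦ Real.cosh (y / 2)) (x + Real.log n))
        - (Real.exp b + b) * (Icc (-b) b).indicator (fun y ↦ Real.cosh (y / 2)) x
      = x * Real.sinh (x / 2)
        + Real.exp (x / 2) / 2 * (((∑ n ∈ Finset.Ioc 0 ⌊Real.exp (b + x)⌋₊, (Λ n : ℝ) / n) - (b + x))
            + (ψ (Real.exp (b - x)) - Real.exp (b - x)))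
        + Real.exp (-(x / 2)) / 2 * ((ψ (Real.exp (b + x)) - Real.exp (b + x))
            + ((∑ n ∈ Finset.Ioc 0 ⌊Real.exp (b - x)⌋₊, (Λ n : ℝ) / n) - (b - x))) := by
  rw [primeShiftOp_coshProfile_eq hx]
  have hxm : x ∈ Icc (-b) b := ⟨hx.1.le, hx.2.le⟩
  rw [indicator_of_mem hxm, Real.cosh_eq, Real.sinh_eq]
  have h1 : Real.exp (x / 2) * Real.exp (b - x) = Real.exp b * Real.exp (-(x / 2)) := by
    rw [← Real.exp_add, ← Real.exp_add]; ring_nf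
  have h2 : Real.exp (-(x / 2)) * Real.exp (b + x) = Real.exp b * Real.exp (x / 2) := by
    rw [← Real.exp_add, ← Real.exp_add]; ring_nf
  linear_combination (1 / 2 : ℝ) * h1 + (1 / 2 : ℝ) * h2

/-! ## §2 Under RH: the pointwise and the `L²` size of the deviation -/

/-- Von Koch's theorem (Literature) in uniform form: under RH there are `K, M ≥ 0` with `|ψ(y) − y| ≤ K√y·(log y)² + M` for all `y ≥ 1`. -/
theorem exists_abs_psi_sub_le_of_RH (hRH : RiemannHypothesis) :
    ∃ K M : ℝ, 0 ≤ K ∧ 0 ≤ M ∧ ∀ y : ℝ, 1 ≤ y → |ψ y - y| ≤ K * Real.sqrt y * Real.log y ^ 2 + M := by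
  have hO := vonKoch_chebyshevPsi_of_riemannHypothesis_holds hRH
  obtain ⟨c, hc0, hcw⟩ := hO.exists_pos
  rw [isBigOWith_iff, eventually_atTop] at hcw
  obtain ⟨y₀, hy₀⟩ := hcw
  set y₁ := max y₀ 1 with hy₁
  refine ⟨c, ψ y₁ + y₁, hc0.le, by have := Chebyshev.psi_nonneg y₁; positivity, fun y hy ↦ ?_⟩
  rcases le_or_gt y₁ y with h | h
  · have h1 := hy₀ y ((le_max_left _ _).trans h)
    have hy0 : 0 ≤ y := by linarith
    rw [Real.norm_eq_abs, Real.norm_eq_abs,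
      abs_of_nonneg (mul_nonneg (Real.rpow_nonneg hy0 _) (sq_nonneg _))] at h1
    have e : c * Real.sqrt y * Real.log y ^ 2 = c * (y ^ (1 / 2 : ℝ) * Real.log y ^ 2) := by
      rw [Real.sqrt_eq_rpow]; ring
    have : 0 ≤ ψ y₁ + y₁ := by have := Chebyshev.psi_nonneg y₁; positivity
    rw [e]; linarith
  · have h1 : |ψ y - y| ≤ ψ y₁ + y₁ := by
      have hψ := Chebyshev.psi_mono h.le
      have hψ0 := Chebyshev.psi_nonneg y
      rw [abs_le]; constructor <;> linarith
    have h2 : 0 ≤ c * Real.sqrt y * Real.log y ^ 2 := by positivity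
    linarith

/-- **RH ⇒ the deviation is pointwise `O(b²e^{b/2})`**: there is `K` with `((T_bC_b)(x) − (e^b + b)C_b(x))² ≤ K·b⁴·e^b` for all
`b ≥ 1`, `|x| < b`. -/
theorem primeShiftOp_coshProfile_sub_sq_le_of_RH (hRH : RiemannHypothesis) :
    ∃ K : ℝ, 0 < K ∧ ∀ b : ℝ, 1 ≤ b → ∀ x ∈ Ioo (-b) b,
      (∑ n ∈ weilPrimeIndex b, (Λ n : ℝ) / Real.sqrt n *
          ((Icc (-b) b).indicator (fun y ↦ Real.cosh (y / 2)) (x - Real.log n)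
            + (Icc (-b) b).indicator (fun y ↦ Real.cosh (y / 2)) (x + Real.log n))
          - (Real.exp b + b) * (Icc (-b) b).indicator (fun y ↦ Real.cosh (y / 2)) x) ^ 2
        ≤ K * b ^ 4 * Real.exp b := by
  obtain ⟨K, M, hK0, hM0, hvk⟩ := exists_abs_psi_sub_le_of_RH hRH
  -- the constant
  refine ⟨5 * (2 * (16 + M ^ 2) + 64 * K ^ 2 + 1), by positivity, fun b hb x hx ↦ ?_⟩
  have hb0 : 0 < b := by linarith
  rw [primeShiftOp_coshProfile_sub_eq hx]
  -- the five pieces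
  set E₁ := (∑ n ∈ Finset.Ioc 0 ⌊Real.exp (b + x)⌋₊, (Λ n : ℝ) / n) - (b + x) with hE₁
  set E₂ := ψ (Real.exp (b - x)) - Real.exp (b - x) with hE₂
  set E₃ := ψ (Real.exp (b + x)) - Real.exp (b + x) with hE₃
  set E₄ := (∑ n ∈ Finset.Ioc 0 ⌊Real.exp (b - x)⌋₊, (Λ n : ℝ) / n) - (b - x) with hE₄
  -- Mertens: `|H(y) − log y| ≤ 4`
  have hH : ∀ y : ℝ, 0 ≤ y → |(∑ n ∈ Finset.Ioc 0 ⌊Real.exp y⌋₊, (Λ n : ℝ) / n) - y| ≤ 4 := by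
    intro y hy
    have h1 : 1 ≤ Real.exp y := by have := Real.add_one_le_exp y; linarith
    have hlo := vonMangoldt_div_sum_ge h1
    have hhi := MertensFirstUpper.sum_vonMangoldt_div_floor_le_log_add h1
    rw [Real.log_exp] at hlo hhi
    rw [abs_le]; constructor <;> linarith
  have h1 : |E₁| ≤ 4 := hE₁ ▸ hH (b + x) (by linarith [hx.1])
  have h4 : |E₄| ≤ 4 := hE₄ ▸ hH (b - x) (by linarith [hx.2])
  -- von Koch: `|ψ(e^y) − e^y| ≤ K e^{y/2} y² + M` for `0 ≤ y ≤ 2b`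
  have hE : ∀ y : ℝ, 0 ≤ y → y ≤ 2 * b → |ψ (Real.exp y) - Real.exp y| ≤ K * Real.exp (y / 2) * (2 * b) ^ 2 + M := by
    intro y hy hy2
    have h1 : 1 ≤ Real.exp y := by have := Real.add_one_le_exp y; linarith
    have h := hvk _ h1
    rw [Real.log_exp, Real.sqrt_eq_rpow, ← Real.exp_mul, show y * (1 / 2 : ℝ) = y / 2 by ring] at h
    have hmono : K * Real.exp (y / 2) * y ^ 2 ≤ K * Real.exp (y / 2) * (2 * b) ^ 2 := by
      have : y ^ 2 ≤ (2 * b) ^ 2 := by nlinarith only [hy, hy2]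
      exact mul_le_mul_of_nonneg_left this (by positivity)
    linarith only [h, hmono]
  have h2 : |E₂| ≤ K * Real.exp ((b - x) / 2) * (2 * b) ^ 2 + M := hE₂ ▸ hE (b - x) (by linarith [hx.2]) (by linarith [hx.1])
  have h3 : |E₃| ≤ K * Real.exp ((b + x) / 2) * (2 * b) ^ 2 + M := hE₃ ▸ hE (b + x) (by linarith [hx.1]) (by linarith [hx.2])
  -- exponential bookkeeping
  have hex1 : Real.exp (x / 2) ^ 2 = Real.exp x := by rw [← Real.exp_nat_mul]; ring_nf
  have hex2 : Real.exp (-(x / 2)) ^ 2 = Real.exp (-x) := by rw [← Real.exp_nat_mul]; ring_nf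
  have hex3 : Real.exp x * Real.exp ((b - x) / 2) ^ 2 = Real.exp b := by
    rw [← Real.exp_nat_mul, ← Real.exp_add]; ring_nf
  have hex4 : Real.exp (-x) * Real.exp ((b + x) / 2) ^ 2 = Real.exp b := by
    rw [← Real.exp_nat_mul, ← Real.exp_add]; ring_nf
  have hexb : Real.exp x ≤ Real.exp b := Real.exp_le_exp.2 hx.2.le
  have hexb' : Real.exp (-x) ≤ Real.exp b := Real.exp_le_exp.2 (by linarith [hx.1])
  -- `x sinh(x/2)` piece: `(x sinh(x/2))² ≤ b² e^b / 4`... we use `sinh(x/2)² ≤ e^{|x|}/4 ≤ e^b/4` and `x² ≤ b²`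
  have hsinh : (x * Real.sinh (x / 2)) ^ 2 ≤ b ^ 2 * Real.exp b := by
    have hs : Real.sinh (x / 2) ^ 2 ≤ Real.exp b := by
      rw [Real.sinh_eq]
      have e1 : Real.exp (x / 2) ≤ Real.exp b := Real.exp_le_exp.2 (by linarith [hx.2])
      have e2 : Real.exp (-(x / 2)) ≤ Real.exp b := Real.exp_le_exp.2 (by linarith [hx.1])
      nlinarith only [hex1, hex2, hexb, hexb', mul_pos (Real.exp_pos (x / 2)) (Real.exp_pos (-(x / 2))), Real.exp_pos b]
    have hx2 : x ^ 2 ≤ b ^ 2 := by nlinarith only [hx.1, hx.2]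
    calc (x * Real.sinh (x / 2)) ^ 2 = x ^ 2 * Real.sinh (x / 2) ^ 2 := by ring
      _ ≤ b ^ 2 * Real.exp b := mul_le_mul hx2 hs (sq_nonneg _) (sq_nonneg b)
  -- squares of the four error pieces
  have hsq1 : (Real.exp (x / 2) / 2 * (E₁ + E₂)) ^ 2 ≤ Real.exp x / 2 * (E₁ ^ 2 + E₂ ^ 2) := by
    rw [show (Real.exp (x / 2) / 2 * (E₁ + E₂)) ^ 2 = Real.exp (x / 2) ^ 2 / 4 * (E₁ + E₂) ^ 2 by ring, hex1]
    nlinarith only [mul_nonneg (Real.exp_pos x).le (sq_nonneg (E₁ - E₂))]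
  have hsq2 : (Real.exp (-(x / 2)) / 2 * (E₃ + E₄)) ^ 2 ≤ Real.exp (-x) / 2 * (E₃ ^ 2 + E₄ ^ 2) := by
    rw [show (Real.exp (-(x / 2)) / 2 * (E₃ + E₄)) ^ 2 = Real.exp (-(x / 2)) ^ 2 / 4 * (E₃ + E₄) ^ 2 by ring, hex2]
    nlinarith only [mul_nonneg (Real.exp_pos (-x)).le (sq_nonneg (E₃ - E₄))]
  have hE1sq : E₁ ^ 2 ≤ 16 := by have := abs_le.1 h1; nlinarith only [this.1, this.2]
  have hE4sq : E₄ ^ 2 ≤ 16 := by have := abs_le.1 h4; nlinarith only [this.1, this.2]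
  have hE2sq : Real.exp x * E₂ ^ 2 ≤ 2 * K ^ 2 * (2 * b) ^ 4 * Real.exp b + 2 * M ^ 2 * Real.exp b := by
    have hab := abs_le.1 h2
    have hsq : E₂ ^ 2 ≤ 2 * (K * Real.exp ((b - x) / 2) * (2 * b) ^ 2) ^ 2 + 2 * M ^ 2 := by
      nlinarith only [hab.1, hab.2, sq_nonneg (K * Real.exp ((b - x) / 2) * (2 * b) ^ 2 - M)]
    have := mul_le_mul_of_nonneg_left hsq (Real.exp_pos x).le
    have e : Real.exp x * (2 * (K * Real.exp ((b - x) / 2) * (2 * b) ^ 2) ^ 2 + 2 * M ^ 2)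
        = 2 * K ^ 2 * (2 * b) ^ 4 * (Real.exp x * Real.exp ((b - x) / 2) ^ 2) + 2 * M ^ 2 * Real.exp x := by ring
    rw [e, hex3] at this
    linarith only [this, mul_le_mul_of_nonneg_left hexb (by positivity : (0 : ℝ) ≤ 2 * M ^ 2)]
  have hE3sq : Real.exp (-x) * E₃ ^ 2 ≤ 2 * K ^ 2 * (2 * b) ^ 4 * Real.exp b + 2 * M ^ 2 * Real.exp b := by
    have hab := abs_le.1 h3
    have hsq : E₃ ^ 2 ≤ 2 * (K * Real.exp ((b + x) / 2) * (2 * b) ^ 2) ^ 2 + 2 * M ^ 2 := by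
      nlinarith only [hab.1, hab.2, sq_nonneg (K * Real.exp ((b + x) / 2) * (2 * b) ^ 2 - M)]
    have := mul_le_mul_of_nonneg_left hsq (Real.exp_pos (-x)).le
    have e : Real.exp (-x) * (2 * (K * Real.exp ((b + x) / 2) * (2 * b) ^ 2) ^ 2 + 2 * M ^ 2)
        = 2 * K ^ 2 * (2 * b) ^ 4 * (Real.exp (-x) * Real.exp ((b + x) / 2) ^ 2) + 2 * M ^ 2 * Real.exp (-x) := by ring
    rw [e, hex4] at this
    linarith only [this, mul_le_mul_of_nonneg_left hexb' (by positivity : (0 : ℝ) ≤ 2 * M ^ 2)]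
  -- `(p₀ + p₁ + p₂)² ≤ 3(p₀² + p₁² + p₂²)` and assembly
  have h3sq : ∀ p₀ p₁ p₂ : ℝ, (p₀ + p₁ + p₂) ^ 2 ≤ 3 * (p₀ ^ 2 + p₁ ^ 2 + p₂ ^ 2) := fun p₀ p₁ p₂ ↦ by
    nlinarith only [sq_nonneg (p₀ - p₁), sq_nonneg (p₁ - p₂), sq_nonneg (p₀ - p₂)]
  refine (h3sq _ _ _).trans ?_
  have heb : 0 < Real.exp b := Real.exp_pos b
  have hE1e : Real.exp x * E₁ ^ 2 ≤ 16 * Real.exp b := by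
    have := mul_le_mul hexb hE1sq (sq_nonneg _) heb.le; linarith [this]
  have hE4e : Real.exp (-x) * E₄ ^ 2 ≤ 16 * Real.exp b := by
    have := mul_le_mul hexb' hE4sq (sq_nonneg _) heb.le; linarith [this]
  have hp1 : (Real.exp (x / 2) / 2 * (E₁ + E₂)) ^ 2 ≤ (8 + 16 * K ^ 2 * b ^ 4 + M ^ 2) * Real.exp b := by
    have e : Real.exp x / 2 * (E₁ ^ 2 + E₂ ^ 2) = (Real.exp x * E₁ ^ 2 + Real.exp x * E₂ ^ 2) / 2 := by ring
    rw [e] at hsq1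
    linarith only [hsq1, hE1e, hE2sq]
  have hp2 : (Real.exp (-(x / 2)) / 2 * (E₃ + E₄)) ^ 2 ≤ (8 + 16 * K ^ 2 * b ^ 4 + M ^ 2) * Real.exp b := by
    have e : Real.exp (-x) / 2 * (E₃ ^ 2 + E₄ ^ 2) = (Real.exp (-x) * E₃ ^ 2 + Real.exp (-x) * E₄ ^ 2) / 2 := by ring
    rw [e] at hsq2
    linarith only [hsq2, hE4e, hE3sq]
  have hb2 : b ^ 2 ≤ b ^ 4 := by
    have hb1 : 1 ≤ b ^ 2 := by nlinarith only [hb]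
    have := mul_le_mul_of_nonneg_left hb1 (by positivity : (0 : ℝ) ≤ b ^ 2)
    nlinarith only [this]
  have hb4 : 1 ≤ b ^ 4 := one_le_pow₀ hb
  have hsum : (x * Real.sinh (x / 2)) ^ 2 + (Real.exp (x / 2) / 2 * (E₁ + E₂)) ^ 2
      + (Real.exp (-(x / 2)) / 2 * (E₃ + E₄)) ^ 2 ≤ (2 * (16 + M ^ 2) + 32 * K ^ 2 + 1) * b ^ 4 * Real.exp b := by
    have h1 := mul_le_mul_of_nonneg_right hb2 heb.le
    have h2 := mul_le_mul_of_nonneg_right hb4 (by positivity : (0 : ℝ) ≤ (16 + 2 * M ^ 2) * Real.exp b)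
    have h0 : 0 ≤ b ^ 4 * Real.exp b := by positivity
    linarith only [hsinh, hp1, hp2, h1, h2, h0]
  have h0a : 0 ≤ M ^ 2 * (b ^ 4 * Real.exp b) := by positivity
  have h0b : 0 ≤ K ^ 2 * (b ^ 4 * Real.exp b) := by positivity
  have h0c : 0 ≤ b ^ 4 * Real.exp b := by positivity
  linarith only [hsum, h0a, h0b, h0c]

/-- **RH ⇒ THE COSH PROFILE IS AN APPROXIMATE EIGENVECTOR OF THE PRIME-SHIFT OPERATOR**: there is `K` with
`∫_{(−b,b)} ((T_bC_b)(x) − (e^b + b)C_b(x))² dx ≤ K·b⁵·(b + sinh b)` for every `b ≥ 1` (and the integrand is integrable there) — the coupling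
of `C_b` to its orthogonal complement is `O(b^{5/2})‖C_b‖` while `Q_b(C_b) ≍ e^b‖C_b‖²`. -/
theorem integral_primeShiftOp_coshProfile_sub_sq_le_of_RH (hRH : RiemannHypothesis) :
    ∃ K : ℝ, 0 < K ∧ ∀ b : ℝ, 1 ≤ b →
      IntegrableOn (fun x ↦ (∑ n ∈ weilPrimeIndex b, (Λ n : ℝ) / Real.sqrt n *
          ((Icc (-b) b).indicator (fun y ↦ Real.cosh (y / 2)) (x - Real.log n)
            + (Icc (-b) b).indicator (fun y ↦ Real.cosh (y / 2)) (x + Real.log n))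
          - (Real.exp b + b) * (Icc (-b) b).indicator (fun y ↦ Real.cosh (y / 2)) x) ^ 2) (Ioo (-b) b) ∧
      ∫ x in Ioo (-b) b, (∑ n ∈ weilPrimeIndex b, (Λ n : ℝ) / Real.sqrt n *
          ((Icc (-b) b).indicator (fun y ↦ Real.cosh (y / 2)) (x - Real.log n)
            + (Icc (-b) b).indicator (fun y ↦ Real.cosh (y / 2)) (x + Real.log n))
          - (Real.exp b + b) * (Icc (-b) b).indicator (fun y ↦ Real.cosh (y / 2)) x) ^ 2
        ≤ K * b ^ 5 * (b + Real.sinh b) := by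
  obtain ⟨K, hK, hpt⟩ := primeShiftOp_coshProfile_sub_sq_le_of_RH hRH
  refine ⟨4 * K, by positivity, fun b hb ↦ ?_⟩
  have hb0 : 0 < b := by linarith
  set C := (Icc (-b) b).indicator (fun y ↦ Real.cosh (y / 2)) with hC
  obtain ⟨hCm, -, -⟩ := coshTest_admissible b
  set f : ℝ → ℝ := fun x ↦ (∑ n ∈ weilPrimeIndex b, (Λ n : ℝ) / Real.sqrt n * (C (x - Real.log n) + C (x + Real.log n))
      - (Real.exp b + b) * C x) ^ 2 with hf
  have hfm : Measurable f := by
    refine (Measurable.sub (Finset.measurable_sum _ fun n _ ↦ ?_) (measurable_const.mul hCm)).pow_const 2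
    exact measurable_const.mul ((hCm.comp (measurable_id.sub_const _)).add (hCm.comp (measurable_id.add_const _)))
  have hvol : volume (Ioo (-b) b) = ENNReal.ofReal (2 * b) := by rw [Real.volume_Ioo]; ring_nf
  have hconst : IntegrableOn (fun _ : ℝ ↦ K * b ^ 4 * Real.exp b) (Ioo (-b) b) :=
    integrableOn_const (by rw [hvol]; exact ENNReal.ofReal_ne_top)
  have hbound : ∀ᵐ x ∂(volume.restrict (Ioo (-b) b)), ‖f x‖ ≤ K * b ^ 4 * Real.exp b := by
    refine (ae_restrict_mem measurableSet_Ioo).mono fun x hx ↦ ?_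
    rw [Real.norm_eq_abs, abs_of_nonneg (by rw [hf]; positivity)]
    exact hpt b hb x hx
  have hint : IntegrableOn f (Ioo (-b) b) := Integrable.mono' hconst hfm.aestronglyMeasurable.restrict hbound
  refine ⟨hint, ?_⟩
  calc ∫ x in Ioo (-b) b, f x ≤ ∫ x in Ioo (-b) b, K * b ^ 4 * Real.exp b :=
        setIntegral_mono_on hint hconst measurableSet_Ioo fun x hx ↦ hpt b hb x hx
    _ = K * b ^ 4 * Real.exp b * (2 * b) := by
        rw [setIntegral_const, smul_eq_mul, Real.volume_real_Ioo_of_le (by linarith)]; ring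
    _ ≤ 4 * K * b ^ 5 * (b + Real.sinh b) := by
        -- `e^b ≤ 2(b + sinh b)` for `b ≥ 1`
        have h1 : Real.exp b ≤ 2 * (b + Real.sinh b) := by
          rw [Real.sinh_eq]
          have : Real.exp (-b) ≤ 1 := Real.exp_le_one_iff.2 (by linarith)
          linarith
        have h2 : 0 ≤ K * b ^ 5 := by positivity
        nlinarith only [h1, h2, hb]

end FloorCoshSplit

end Summit.RiemannHypothesis.RiemannHypothesis.Theorems.WeilFormatC
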